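import Mathlib
import Literature.AlgebraicGeometry.Resolution.CobordantGame
import Literature.AlgebraicGeometry.Resolution.CobordantChartCoefficients
import Literature.AlgebraicGeometry.Resolution.CobordantChartPlaneSlice
import Literature.AlgebraicGeometry.Resolution.AxisPolyhedron
import Summits.ResolutionOfSingularities.ResolutionOfSingularities.Theorems.WeightedInvariantLocalWeightedDropAxisPointMove
import Summits.ResolutionOfSingularities.ResolutionOfSingularities.Theorems.WeightedInvariantLocalWeightedDropAxisWeightedMoveRotate
import Summits.ResolutionOfSingularities.ResolutionOfSingularities.Theorems.WeightedInvariantLocalWeightedDropAxisWeightedMoveSlice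
import Summits.ResolutionOfSingularities.ResolutionOfSingularities.Theorems.WeightedInvariantLocalWeightedDropAxisNearDescentCoeff
import Summits.ResolutionOfSingularities.ResolutionOfSingularities.Theorems.WeightedInvariantLocalWeightedDropAxisNearDescent

/-!
# `LocalWeightedDrop` (stmt-ResolutionOfSingularities-8899), TOT2-LINE piece S-E1 (core, part 3):
# ONE STEP OF THE FUNDAMENTAL SEQUENCE at an `e = 1` point — the dichotomy and the integer measure

Route `ResolutionOfSingularities/WeightedInvariant`, crux `LocalWeightedDrop`, registered residual
`stub_spaceNCRankDrop` (skeleton v32), sub-line TOT2-LINE v1 §5 (E1) [OURS · L1 W4.3; AI-drafted, weaker than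
expert review].  Same setting as `…AxisNearDescentCoeff` / `…AxisNearDescent`: `S` an axis germ of order `d`
(`AxisCone`, `TrivialApexX`), the point move with all weights `1`, the axis point `c = (0, c_z)`, `c_z ≠ 0`,
`S(chart) = s^d · G`, the `z`-slot slice `Sl = G|_{y_z = 0}` and its rotation `N` (exceptional variable last).

**Results.**
* `aboveLevel_of_lineEmpty` — `δ ≥ M` with the level-`M` line empty forces `δ ≥ M + 1/d` (the slopes
  `γ / (d - |a|)` have denominators `≤ d`);
* `exists_not_aboveLevel_of_not_inAxisIdeal`, `not_aboveLevel_nearSucc` — THE INTEGER MEASURE: when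
  `δ(S) < ∞` some integer level `r` fails, and `δ(S) < r + 1 ⇒ δ(N) < r`; so along near axis-point blow-ups the
  least failing integer level drops by one per step;
* `apexFree_slice_pointMove` — the point-move (`m = 1`) instance of `AxisWeightedMove.apexFree_slice`: for a
  PREPARED axis germ with `δ(S) ≥ 2` whose level-`2` line is NON-EMPTY (`δ = 2` exactly) the slice at the axis
  point is APEX-FREE (`k` infinite) — so the point blow-up after it has no near point at all
  (`stub_apexFreeOrderDrop`);
* `nearChain_length_le` — **CHAINS OF NEAR AXIS-POINT BLOW-UPS ARE SHORT**: if `δ(S₀) < r` then every chain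
  `S₀ → S₁ → … → S_ℓ` of order-`d` rotated axis-point successors has `ℓ + 2 ≤ r` (needs no cone / apex /
  preparedness hypothesis — those serve to show that the actual near points of the play ARE these axis points);
* **`nearSucc_step`** — THE DICHOTOMY at a near step (every field): from a prepared axis germ with `δ(S) ≥ 2`
  the rotated successor `N` has order `d`, trivial apex inside `z = 0`, is prepared, has `δ(N) = δ(S) - 1`
  (threshold-wise) and `δ(N) = ∞ ↔ δ(S) = ∞`; and if the level-`2` line of `S` is EMPTY it is again an axis
  germ (`AxisCone d N`), to which this very theorem applies at the next step.
Together with B3 (`stub_axisPointMove`: `δ < 2` ⇒ no near successor; off-axis points are never near) and B1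
(`stub_axisPreparation`) this is the complete local algebra of CJS's `e = 1` termination (Thm 5.35 / §9) under
POINT blow-ups; the decorated statement on S-SET's `Decoration`s (history `O`, `e^O`) is the sequel.
-/

set_option linter.dupNamespace false -- mandated namespace of this single-conjunct summit

namespace Summit.ResolutionOfSingularities.ResolutionOfSingularities.Theorems

open Literature.AlgebraicGeometry.Resolution

namespace AxisNearDescent

open MvPowerSeries AxisPolyhedron

variable {k : Type} [Field k] {n : ℕ}

/-! ### Integer levels: the empty line and the integer measure -/

/-- `δ(g) ≥ M` AND THE LEVEL-`M` LINE EMPTY force `δ(g) ≥ M + 1/d`: a slope `γ/(d - |a|) > M` with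
`1 ≤ d - |a| ≤ d` is at least `M + 1/d`. -/
theorem aboveLevel_of_lineEmpty {d M : ℕ} {g : MvPowerSeries (Fin (n + 1)) k} (hlev : AboveLevel d M 1 g)
    (hempty : ∀ E : Fin (n + 1) →₀ ℕ, xDeg E < d → E (Fin.last n) = M * (d - xDeg E) → coeff E g = 0) :
    AboveLevel d (M * d + 1) d g := by
  intro E hx hlt
  rcases Nat.lt_trichotomy (E (Fin.last n)) (M * (d - xDeg E)) with h | h | h
  · exact hlev E hx (by rw [one_mul]; exact h)
  · exact hempty E hx h
  · exfalso
    have h1 : (M * d + 1) * (d - xDeg E) = d * (M * (d - xDeg E)) + (d - xDeg E) := by ring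
    have h2 : d * (M * (d - xDeg E) + 1) ≤ d * E (Fin.last n) := Nat.mul_le_mul_left d h
    rw [h1] at hlt
    rw [Nat.mul_add, mul_one] at h2
    omega

/-- When `δ(g) < ∞` (a monomial of `x'`-degree `< d` exists) SOME INTEGER LEVEL FAILS. -/
theorem exists_not_aboveLevel_of_not_inAxisIdeal {d : ℕ} {g : MvPowerSeries (Fin (n + 1)) k}
    (h : ¬ InAxisIdeal d g) : ∃ r : ℕ, ¬ AboveLevel d r 1 g := by
  obtain ⟨E, hx, hne⟩ : ∃ E : Fin (n + 1) →₀ ℕ, xDeg E < d ∧ coeff E g ≠ 0 := by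
    by_contra hno
    push Not at hno
    exact h hno
  refine ⟨E (Fin.last n) + 1, fun hA => hne (hA E hx ?_)⟩
  rw [one_mul, Nat.add_mul, one_mul]
  have : E (Fin.last n) ≤ E (Fin.last n) * (d - xDeg E) := Nat.le_mul_of_pos_right _ (by omega)
  omega

/-- **THE INTEGER MEASURE DROPS**: `δ(S) < r + 1 ⇒ δ(N) < r` for the rotated near successor `N`
(`aboveLevel_nearSucc_iff` at `q = 1`). -/
theorem not_aboveLevel_nearSucc {S : MvPowerSeries (Fin (n + 1)) k} {c : Fin (n + 1) → k}
    (hc : ∀ j : Fin n, c (Fin.castSucc j) = 0) (hcz : c (Fin.last n) ≠ 0) {d : ℕ}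
    {G : MvPowerSeries (Fin (n + 2)) k}
    (hfac : subst (CobordantChart.chart (fun _ : Fin (n + 1) => 1) c) S = X 0 ^ d * G)
    {N : MvPowerSeries (Fin (n + 1)) k}
    (hN : N = rename (⇑(finRotate (n + 1)).symm)
      (subst (fun j : Fin (n + 2) => if j = (Fin.last n).succ then (0 : MvPowerSeries (Fin (n + 1)) k)
        else X (Fin.predAbove (Fin.last n) j)) G))
    (hord : ∀ E : Fin (n + 1) →₀ ℕ, coeff E S ≠ 0 → d ≤ E.degree) {r : ℕ}
    (hr : ¬ AboveLevel d (r + 1) 1 S) : ¬ AboveLevel d r 1 N :=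
  fun h => hr ((aboveLevel_nearSucc_iff hc hcz hfac hN hord r 1).mp h)

/-- The least failing integer level is at least `3` when `δ ≥ 2` and the level-`2` line is empty (so the measure
of the successor, one less, is still `≥ 2`: consistent with `N` being an axis germ of `δ ≥ 1 + 1/d`). -/
theorem three_le_of_not_aboveLevel {d r : ℕ} {g : MvPowerSeries (Fin (n + 1)) k} (hd : 1 ≤ d)
    (hlev : AboveLevel d 2 1 g)
    (hempty : ∀ E : Fin (n + 1) →₀ ℕ, xDeg E < d → E (Fin.last n) = 2 * (d - xDeg E) → coeff E g = 0)
    (hr : ¬ AboveLevel d r 1 g) : 3 ≤ r := by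
  by_contra hlt
  push Not at hlt
  apply hr
  intro E hx hEz
  have hA := aboveLevel_of_lineEmpty hlev hempty
  refine hA E hx ?_
  have h1 : (2 * d + 1) * (d - xDeg E) = d * (2 * (d - xDeg E)) + (d - xDeg E) := by ring
  have h2 : d * E (Fin.last n) < d * (r * (d - xDeg E)) := Nat.mul_lt_mul_of_pos_left (by simpa using hEz) hd
  have h3 : d * (r * (d - xDeg E)) ≤ d * (2 * (d - xDeg E)) :=
    Nat.mul_le_mul_left d (Nat.mul_le_mul_right _ (by omega))
  rw [h1]
  omega

/-! ### The `δ = 2` boundary: the successor is apex-free -/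

/-- **APEX-FREE SUCCESSOR WHEN THE LEVEL-`2` LINE IS NON-EMPTY** (`δ(S) = 2` exactly; `k` infinite): the
point-move instance (`m = 1`) of `AxisWeightedMove.apexFree_slice`.  For a PREPARED axis germ `S` (`AxisCone`,
`TrivialApexX`, `PreparedAxis`, `δ ≥ 2`) with a monomial on the line `γ = 2(d - |a|)`, the slice at the axis
point has NO non-zero translation-invariance vector of its degree-`d` form — the next point blow-up has no near
point (`stub_apexFreeOrderDrop`).  (A vector `(t, u')` with `t ≠ 0` in the apex would solve the level-`2` vertex by
`-u'/(t c_z²)` — excluded by preparedness unless `u' = 0`, when the line would be empty; `t = 0` contradicts the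
trivial apex of `F`.) -/
theorem apexFree_slice_pointMove [Infinite k] {S : MvPowerSeries (Fin (n + 1)) k} {c : Fin (n + 1) → k}
    (hc : ∀ j : Fin n, c (Fin.castSucc j) = 0) (hcz : c (Fin.last n) ≠ 0) {d : ℕ}
    {G : MvPowerSeries (Fin (n + 2)) k}
    (hfac : subst (CobordantChart.chart (fun _ : Fin (n + 1) => 1) c) S = X 0 ^ d * G)
    (hlev : AboveLevel d 2 1 S) (hcone : AxisCone d S) (hapex : TrivialApexX d S) (hprep : PreparedAxis d S)
    (hline : ∃ E : Fin (n + 1) →₀ ℕ, xDeg E < d ∧ E (Fin.last n) = 2 * (d - xDeg E) ∧ coeff E S ≠ 0)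
    (u : Fin (n + 1) → k) (hu : u ≠ 0) :
    ∃ v : Fin (n + 1) → k,
      CobordantChart.initEval (fun _ : Fin (n + 1) => 1) (v + u) d
          (subst (fun j : Fin (n + 2) => if j = (Fin.last n).succ then (0 : MvPowerSeries (Fin (n + 1)) k)
            else X (Fin.predAbove (Fin.last n) j)) G) ≠
        CobordantChart.initEval (fun _ : Fin (n + 1) => 1) v d
          (subst (fun j : Fin (n + 2) => if j = (Fin.last n).succ then (0 : MvPowerSeries (Fin (n + 1)) k)
            else X (Fin.predAbove (Fin.last n) j)) G) := by
  have hfac' : subst (CobordantChart.chart (fun _ : Fin (n + 1) => 1) c) S = X 0 ^ (1 * d) * G := by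
    rw [Nat.one_mul]; exact hfac
  exact AxisWeightedMove.apexFree_slice (w := fun _ : Fin (n + 1) => 1) (m := 1) rfl (fun _ => rfl) le_rfl
    hfac' hc hcz hlev hcone hapex hprep hline u hu

/-! ### One step of the fundamental sequence: the dichotomy -/

/-- **ONE NEAR STEP AT AN `e = 1` POINT** (every field, every dimension).  From a PREPARED AXIS GERM `S` of order
`d` with `δ(S) ≥ 2`, at the axis point `c = (0, c_z)`, `c_z ≠ 0`, the rotated successor `N` (exceptional
variable last): has order `d`; has trivial apex inside `z = 0` (its degree-`d` form restricted to `z = 0` is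
`F`); is again prepared; `δ(N) = δ(S) - 1` threshold-wise and `δ(N) = ∞ ↔ δ(S) = ∞`; and IF THE LEVEL-`2` LINE
OF `S` IS EMPTY it is again an axis germ (`AxisCone d N`) — the regime persists and `δ` has dropped by one.
(If the line is non-empty, `apexFree_slice_pointMove`: the regime is left through an apex-free point.) -/
theorem nearSucc_step {S : MvPowerSeries (Fin (n + 1)) k} {c : Fin (n + 1) → k}
    (hc : ∀ j : Fin n, c (Fin.castSucc j) = 0) (hcz : c (Fin.last n) ≠ 0) {d : ℕ}
    {G : MvPowerSeries (Fin (n + 2)) k}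
    (hfac : subst (CobordantChart.chart (fun _ : Fin (n + 1) => 1) c) S = X 0 ^ d * G)
    {N : MvPowerSeries (Fin (n + 1)) k}
    (hN : N = rename (⇑(finRotate (n + 1)).symm)
      (subst (fun j : Fin (n + 2) => if j = (Fin.last n).succ then (0 : MvPowerSeries (Fin (n + 1)) k)
        else X (Fin.predAbove (Fin.last n) j)) G))
    (hSd : S.order = d) (hcone : AxisCone d S) (hapex : TrivialApexX d S) (hprep : PreparedAxis d S)
    (hlev : AboveLevel d 2 1 S) :
    N.order = d ∧ TrivialApexX d N ∧ PreparedAxis d N ∧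
      (∀ r q : ℕ, AboveLevel d r q N ↔ AboveLevel d (r + q) q S) ∧
      (InAxisIdeal d N ↔ InAxisIdeal d S) ∧
      ((∀ E : Fin (n + 1) →₀ ℕ, xDeg E < d → E (Fin.last n) = 2 * (d - xDeg E) → coeff E S = 0) →
        AxisCone d N) := by
  have hord : ∀ E : Fin (n + 1) →₀ ℕ, coeff E S ≠ 0 → d ≤ E.degree := le_degree_of_coeff_ne_zero hSd
  refine ⟨order_nearSucc_eq hc hfac hN hSd hcone hlev, trivialApexX_nearSucc hc hfac hN hapex,
    preparedAxis_nearSucc hc hcz hfac hN hord hprep, fun r q => aboveLevel_nearSucc_iff hc hcz hfac hN hord r q,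
    inAxisIdeal_nearSucc_iff hc hcz hfac hN hord, fun hempty => ?_⟩
  exact axisCone_nearSucc hc hfac hN (aboveLevel_of_lineEmpty hlev hempty) (by omega)

/-! ### Chains of near axis-point blow-ups are short -/

/-- `AboveLevel` is antitone in the level. -/
theorem aboveLevel_mono {d r r' q : ℕ} {g : MvPowerSeries (Fin (n + 1)) k} (h : AboveLevel d r q g) (hr : r' ≤ r) :
    AboveLevel d r' q g :=
  fun E hx hlt => h E hx (lt_of_lt_of_le hlt (Nat.mul_le_mul_right _ hr))

/-- A series of order `≥ d` has `δ ≥ 1`. -/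
theorem aboveLevel_one_of_le_degree {d : ℕ} {g : MvPowerSeries (Fin (n + 1)) k}
    (hord : ∀ E : Fin (n + 1) →₀ ℕ, coeff E g ≠ 0 → d ≤ E.degree) : AboveLevel d 1 1 g := by
  intro E hx hlt
  by_contra hne
  have h := hord E hne
  rw [AxisPreparation.degree_eq_xDeg_add] at h
  omega

/-- **CHAINS OF NEAR AXIS-POINT BLOW-UPS ARE SHORT** (every field; no cone, apex or preparedness hypothesis is
needed for this count).  Let `S₀, S₁, …, S_ℓ` be series of order `d` where each `S_{i+1}` is the rotated `z`-slot
slice of the point blow-up of `S_i` at an axis point `(0, c_i)`, `c_i ≠ 0` (`S_i(chart) = s^d G_i`).  If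
`δ(S₀) < r` (the integer level `r` fails) then `ℓ + 2 ≤ r`: `δ` drops by one per step
(`not_aboveLevel_nearSucc`) and a near step needs `δ ≥ 2` (`le_order_nearSucc_iff`). -/
theorem nearChain_length_le {d r : ℕ} (S : ℕ → MvPowerSeries (Fin (n + 1)) k) (c : ℕ → Fin (n + 1) → k)
    (G : ℕ → MvPowerSeries (Fin (n + 2)) k) (ℓ : ℕ)
    (hord : ∀ i ≤ ℓ, (S i).order = d) (hr : ¬ AboveLevel d r 1 (S 0))
    (hc : ∀ i < ℓ, ∀ j : Fin n, c i (Fin.castSucc j) = 0) (hcz : ∀ i < ℓ, c i (Fin.last n) ≠ 0)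
    (hfac : ∀ i < ℓ, subst (CobordantChart.chart (fun _ : Fin (n + 1) => 1) (c i)) (S i) = X 0 ^ d * G i)
    (hN : ∀ i < ℓ, S (i + 1) = rename (⇑(finRotate (n + 1)).symm)
      (subst (fun j : Fin (n + 2) => if j = (Fin.last n).succ then (0 : MvPowerSeries (Fin (n + 1)) k)
        else X (Fin.predAbove (Fin.last n) j)) (G i))) :
    ℓ + 2 ≤ r := by
  -- `δ(S_i) < r - i` along the chain
  have hmeas : ∀ i ≤ ℓ, ¬ AboveLevel d (r - i) 1 (S i) := by
    intro i
    induction i with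
    | zero => exact fun _ => hr
    | succ i ih =>
      intro hi
      have hi' : i < ℓ := Nat.lt_of_succ_le hi
      have h := not_aboveLevel_nearSucc (hc i hi') (hcz i hi') (hfac i hi') (hN i hi')
        (le_degree_of_coeff_ne_zero (hord i hi'.le)) (r := r - (i + 1)) ?_
      · exact h
      · intro hA
        refine ih hi'.le (aboveLevel_mono hA ?_)
        omega
  rcases Nat.eq_zero_or_pos ℓ with hℓ | hℓ
  · -- no step: `δ(S₀) ≥ 1` forces `r ≥ 2`
    subst hℓ
    by_contra hlt
    exact hr (aboveLevel_mono (aboveLevel_one_of_le_degree (le_degree_of_coeff_ne_zero (hord 0 le_rfl)))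
      (by omega))
  · -- the last step is near: `δ(S_{ℓ-1}) ≥ 2`, while `δ(S_{ℓ-1}) < r - (ℓ - 1)`
    obtain ⟨m, rfl⟩ : ∃ m, ℓ = m + 1 := ⟨ℓ - 1, by omega⟩
    have hm : m < m + 1 := Nat.lt_succ_self m
    have hnear : (d : ℕ∞) ≤ (S (m + 1)).order := by rw [hord (m + 1) le_rfl]
    have h2 : AboveLevel d 2 1 (S m) :=
      (le_order_nearSucc_iff (hc m hm) (hcz m hm) (hfac m hm) (hN m hm)
        (le_degree_of_coeff_ne_zero (hord m hm.le))).mp hnear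
    by_contra hlt
    exact hmeas m hm.le (aboveLevel_mono h2 (by omega))

end AxisNearDescent

end Summit.ResolutionOfSingularities.ResolutionOfSingularities.Theorems
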